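import Summits.FinalStateConjecture.FinalStateConjecture.Statement
import HarnessLib

/-!
# Crux `LinearToNonlinearCapture` (stmt-FinalStateConjecture-14526), line `Sketch` —
# registered stub `stub_settlesOfConverges` (bookkeeping half of the crux)

Given the chart data of `RecurrentMultiKerrCapture`'s hypothesis — sub-extremal parameters, hole
charts `Ψᵢ` and a flat chart `Ψ₀` which are late charts into `O` after `τ₀`, sublinear excision
radii `ρᵢ`, exhaustion radii `Rᵢ → ∞`, the flat domain containing the late half-space minus the
excised tubes, separation of the holes, `O` the exterior region of the charted late region, and
exhaustion of `O` by the certified regions for every `τ₁ > τ₀` — together with CONVERGENCE of the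
`C²` deviations in these charts and the causal fact that open sets lie in their own chronological
past, the same charts restarted at chart time `τ₀ + 1` form a `C²` final state decomposition `d`
of `O' := exteriorOf (charted late region after τ₀ + 1)`, with `O' = exteriorOf d.charted`
definitionally and `HasExhaustiveCharts d` witnessed by the radii `Rᵢ`. Pure set/causal plumbing
over `FinalStateDecomposition` (`KerrConvergence.lean`) and the Statement's auxiliaries
`exteriorOf`, `certifiedLate`, `certifiedSlab`, `HasExhaustiveCharts`; Mathlib only otherwise.
-/

open scoped Topology Manifold ENNReal ContDiff
open Filter Set Function TopologicalSpace Literature.Geometry.Lorentzian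

universe u

namespace Summit.FinalStateConjecture.FinalStateConjecture.Theorems

/-- A late region `{t > τ}` of a reference background with continuous time function is open in the
reference domain. [folklore] -/
private theorem isOpen_lateRegion_of_continuous_time (B : ModelBackground) (hB : Continuous B.time)
    (τ : ℝ) : IsOpen (B.lateRegion τ) :=
  isOpen_lt continuous_const (hB.comp continuous_subtype_val)

/-- **Restarting a late chart at a later time.** A late chart after `τ₀` into `O` is a late chart
after any `τ₁ ≥ τ₀` into any region `O'` containing the image of the late region `{t > τ₁}`,
provided that late region is open (the open embedding restricts along the open inclusion
`{t > τ₁} ↪ {t > τ₀}`). [folklore] -/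
private theorem isLateChart_restart {𝓢 : Spacetime.{u} 4} {B : ModelBackground}
    {O O' : Set 𝓢.carrier} {τ₀ τ₁ : ℝ} {Ψ : B.domain → 𝓢.carrier}
    (h : 𝓢.IsLateChart B O τ₀ Ψ) (hτ : τ₀ ≤ τ₁) (hopen : IsOpen (B.lateRegion τ₁))
    (hO' : Ψ '' B.lateRegion τ₁ ⊆ O') : 𝓢.IsLateChart B O' τ₁ Ψ where
  contMDiff := h.contMDiff
  isOpenEmbedding := h.isOpenEmbedding.comp
    (Topology.IsOpenEmbedding.inclusion (B.lateRegion_mono hτ)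
      (hopen.preimage continuous_subtype_val))
  image_subset := hO'

/-- The image of a later (open) late region `{t > τ₁}`, `τ₁ ≥ τ₀`, under a late chart after `τ₀`
is open in the spacetime. [folklore] -/
private theorem isOpen_image_lateRegion {𝓢 : Spacetime.{u} 4} {B : ModelBackground}
    {O : Set 𝓢.carrier} {τ₀ τ₁ : ℝ} {Ψ : B.domain → 𝓢.carrier}
    (h : 𝓢.IsLateChart B O τ₀ Ψ) (hτ : τ₀ ≤ τ₁) (hopen : IsOpen (B.lateRegion τ₁)) :
    IsOpen (Ψ '' B.lateRegion τ₁) := by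
  rw [← range_restrict]
  exact (h.isOpenEmbedding.comp (Topology.IsOpenEmbedding.inclusion (B.lateRegion_mono hτ)
    (hopen.preimage continuous_subtype_val))).isOpen_range

/-- **Stub S1** (settling from convergence in the anchored charts; bookkeeping half of the
crux `LinearToNonlinearCapture`, stmt-FinalStateConjecture-14526). Given the chart data of
`RecurrentMultiKerrCapture`'s hypothesis — sub-extremal parameters, hole charts `Ψᵢ` and a flat
chart `Ψ₀` which are late charts into `O` after `τ₀`, sublinear excision radii `ρᵢ`, exhaustion
radii `Rᵢ → ∞`, the flat domain containing the late half-space minus the excised tubes, separation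
of the holes, `O` the exterior region of the charted late region, and exhaustion of `O` by the
certified regions for every `τ₁ > τ₀` — and CONVERGENCE of the `C²` deviations in these charts
(flat: on whole slabs; holes: out to `Rᵢ(τ)`), together with the causal fact that open sets lie in
their own chronological past, the charts restarted at `τ₀ + 1` form a `C²` final state
decomposition `d` of `O' := exteriorOf (charted late region after τ₀ + 1)` with
`O' = exteriorOf d.charted` and `HasExhaustiveCharts d` (radii `Rᵢ`). -/
theorem stub_settlesOfConverges
    {X : Type} [TopologicalSpace X] [ChartedSpace E3 X] [IsManifold (𝓡 3) ∞ X]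
    [T2Space X] [SecondCountableTopology X] [ConnectedSpace X]
    {D : InitialDataSet (𝓡 3) X} (𝒟 : VacuumCauchyDevelopment D)
    (O : Set 𝒟.carrier) (N : ℕ) (M a : Fin N → ℝ) (mo : Fin N → lorentzGroup × E4) (τ₀ : ℝ)
    (Ψ : ∀ i, boostedKerrExterior (mo i).1 (mo i).2 (M i) (a i) → 𝒟.carrier)
    (ρ R : Fin N → ℝ → ℝ) (U₀ : Opens E4) (Ψ₀ : U₀ → 𝒟.carrier)
    (hsub : ∀ i, Kerr.IsSubextremal (M i) (a i))
    (hΨ : ∀ i, 𝒟.toSpacetime.IsLateChart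
      (boostedKerrBackground (mo i).1 (mo i).2 (M i) (a i)) O τ₀ (Ψ i))
    (hΨ₀ : 𝒟.toSpacetime.IsLateChart (Minkowski.backgroundOn U₀) O τ₀ Ψ₀)
    (hρ : ∀ i, Tendsto (fun t ↦ ρ i t / t) atTop (𝓝 0))
    (hR : ∀ i, Tendsto (R i) atTop atTop)
    (hU₀ : {x : E4 | τ₀ < x 0 ∧
      ∀ i, ρ i (x 0) < Kerr.radius (a i) (poincareInv (mo i).1 (mo i).2 x)} ⊆ (U₀ : Set E4))
    (hsep : ∀ R' : ℝ, ∃ τ₁ : ℝ, Pairwise (Function.onFun Disjoint fun i ↦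
      Ψ i '' (boostedKerrBackground (mo i).1 (mo i).2 (M i) (a i)).truncLateRegion τ₁ R'))
    (hO : O = Summit.FinalStateConjecture.exteriorOf 𝒟.toCauchyDevelopment
      ((⋃ i, Ψ i '' (boostedKerrBackground (mo i).1 (mo i).2 (M i) (a i)).lateRegion τ₀) ∪
        Ψ₀ '' (Minkowski.backgroundOn U₀).lateRegion τ₀))
    (hexh : ∀ τ₁ : ℝ, τ₀ < τ₁ →
      O \ (Ψ₀ '' (Minkowski.backgroundOn U₀).lateRegion τ₁ ∪
        ⋃ i, Ψ i '' {x | τ₁ < (boostedKerrBackground (mo i).1 (mo i).2 (M i) (a i)).time x.1 ∧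
          (boostedKerrBackground (mo i).1 (mo i).2 (M i) (a i)).radius x.1 ≤
            R i ((boostedKerrBackground (mo i).1 (mo i).2 (M i) (a i)).time x.1)}) ⊆
      𝒟.metric.causalPast 𝒟.timeOrientation
        (Ψ₀ '' (Minkowski.backgroundOn U₀).timeSlab τ₁ ∪
          ⋃ i, Ψ i '' (boostedKerrBackground (mo i).1 (mo i).2 (M i) (a i)).truncTimeSlab
            (R i τ₁) τ₁))
    (hflat : Tendsto (fun τ ↦ 𝒟.toSpacetime.deviationCk (Minkowski.backgroundOn U₀) Ψ₀ 2 τ)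
      atTop (𝓝 0))
    (hholes : ∀ i, Tendsto (fun τ ↦ 𝒟.toSpacetime.truncDeviationCk
      (boostedKerrBackground (mo i).1 (mo i).2 (M i) (a i)) (Ψ i) 2 (R i τ) τ) atTop (𝓝 0))
    (hopen : ∀ V : Set 𝒟.carrier, IsOpen V →
      V ⊆ 𝒟.metric.chronologicalPast 𝒟.timeOrientation V) :
    ∃ (O' : Set 𝒟.carrier) (d : FinalStateDecomposition 𝒟.toSpacetime O' 2),
      (∀ i, Kerr.IsSubextremal (d.mass i) (d.spin i)) ∧
        O' = Summit.FinalStateConjecture.exteriorOf 𝒟.toCauchyDevelopment d.charted ∧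
          Summit.FinalStateConjecture.HasExhaustiveCharts d := by
  have h1 : τ₀ ≤ τ₀ + 1 := (lt_add_one τ₀).le
  -- continuity of the chart times, openness of the late regions and of their images
  have hcK : ∀ i, Continuous (boostedKerrBackground (mo i).1 (mo i).2 (M i) (a i)).time :=
    fun i ↦ (PiLp.continuous_apply 2 _ 0).comp (continuous_poincareInv _ _)
  have hc0 : Continuous (Minkowski.backgroundOn U₀).time := PiLp.continuous_apply 2 _ 0
  have hoK : ∀ i (τ : ℝ),
      IsOpen ((boostedKerrBackground (mo i).1 (mo i).2 (M i) (a i)).lateRegion τ) :=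
    fun i τ ↦ isOpen_lateRegion_of_continuous_time _ (hcK i) τ
  have ho0 : ∀ τ : ℝ, IsOpen ((Minkowski.backgroundOn U₀).lateRegion τ) :=
    fun τ ↦ isOpen_lateRegion_of_continuous_time _ hc0 τ
  -- the restarted charted late region `C` is open, lies in the original one and in `O`
  have hCopen : IsOpen (Ψ₀ '' (Minkowski.backgroundOn U₀).lateRegion (τ₀ + 1) ∪
      ⋃ i, Ψ i '' (boostedKerrBackground (mo i).1 (mo i).2 (M i) (a i)).lateRegion (τ₀ + 1)) :=
    (isOpen_image_lateRegion hΨ₀ h1 (ho0 _)).union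
      (isOpen_iUnion fun i ↦ isOpen_image_lateRegion (hΨ i) h1 (hoK i _))
  have hCC₀ : (Ψ₀ '' (Minkowski.backgroundOn U₀).lateRegion (τ₀ + 1) ∪
      ⋃ i, Ψ i '' (boostedKerrBackground (mo i).1 (mo i).2 (M i) (a i)).lateRegion (τ₀ + 1)) ⊆
      (⋃ i, Ψ i '' (boostedKerrBackground (mo i).1 (mo i).2 (M i) (a i)).lateRegion τ₀) ∪
        Ψ₀ '' (Minkowski.backgroundOn U₀).lateRegion τ₀ :=
    union_subset (subset_union_of_subset_right
      (image_mono ((Minkowski.backgroundOn U₀).lateRegion_mono h1)) _)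
      (subset_union_of_subset_left (iUnion_mono fun i ↦ image_mono
        ((boostedKerrBackground (mo i).1 (mo i).2 (M i) (a i)).lateRegion_mono h1)) _)
  have hCO : (Ψ₀ '' (Minkowski.backgroundOn U₀).lateRegion (τ₀ + 1) ∪
      ⋃ i, Ψ i '' (boostedKerrBackground (mo i).1 (mo i).2 (M i) (a i)).lateRegion (τ₀ + 1)) ⊆
      O :=
    union_subset
      ((image_mono ((Minkowski.backgroundOn U₀).lateRegion_mono h1)).trans hΨ₀.image_subset)
      (iUnion_subset fun i ↦ (image_mono ((boostedKerrBackground (mo i).1 (mo i).2 (M i)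
        (a i)).lateRegion_mono h1)).trans (hΨ i).image_subset)
  -- the restarted exterior region `O'` lies in `O` and contains `C`
  have hO'O : Summit.FinalStateConjecture.exteriorOf 𝒟.toCauchyDevelopment
      (Ψ₀ '' (Minkowski.backgroundOn U₀).lateRegion (τ₀ + 1) ∪
        ⋃ i, Ψ i '' (boostedKerrBackground (mo i).1 (mo i).2 (M i) (a i)).lateRegion (τ₀ + 1)) ⊆
      O := fun p hp ↦
    hO ▸ (⟨hp.1, LorentzianMetric.chronologicalFuture_mono (τ := 𝒟.timeOrientation.reverse)
      hCC₀ hp.2⟩ : p ∈ Summit.FinalStateConjecture.exteriorOf 𝒟.toCauchyDevelopment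
        ((⋃ i, Ψ i '' (boostedKerrBackground (mo i).1 (mo i).2 (M i) (a i)).lateRegion τ₀) ∪
          Ψ₀ '' (Minkowski.backgroundOn U₀).lateRegion τ₀))
  have hOJ : O ⊆ 𝒟.metric.causalFuture 𝒟.timeOrientation (range 𝒟.embed) := fun p hp ↦
    (hO ▸ hp : p ∈ Summit.FinalStateConjecture.exteriorOf 𝒟.toCauchyDevelopment
      ((⋃ i, Ψ i '' (boostedKerrBackground (mo i).1 (mo i).2 (M i) (a i)).lateRegion τ₀) ∪
        Ψ₀ '' (Minkowski.backgroundOn U₀).lateRegion τ₀)).1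
  have hCO' : (Ψ₀ '' (Minkowski.backgroundOn U₀).lateRegion (τ₀ + 1) ∪
      ⋃ i, Ψ i '' (boostedKerrBackground (mo i).1 (mo i).2 (M i) (a i)).lateRegion (τ₀ + 1)) ⊆
      Summit.FinalStateConjecture.exteriorOf 𝒟.toCauchyDevelopment
        (Ψ₀ '' (Minkowski.backgroundOn U₀).lateRegion (τ₀ + 1) ∪
          ⋃ i, Ψ i '' (boostedKerrBackground (mo i).1 (mo i).2 (M i) (a i)).lateRegion
            (τ₀ + 1)) :=
    subset_inter (hCO.trans hOJ) (hopen _ hCopen)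
  -- near-zone convergence for every fixed radius, from convergence out to `Rᵢ(τ) → ∞`
  have htrunc : ∀ i (R' : ℝ), Tendsto (fun τ ↦ 𝒟.toSpacetime.truncDeviationCk
      (boostedKerrBackground (mo i).1 (mo i).2 (M i) (a i)) (Ψ i) 2 R' τ) atTop (𝓝 0) :=
    fun i R' ↦ tendsto_of_tendsto_of_tendsto_of_le_of_le' tendsto_const_nhds (hholes i)
      (Eventually.of_forall fun _ ↦ zero_le)
      (((hR i).eventually_ge_atTop R').mono fun τ hτ ↦
        𝒟.toSpacetime.truncDeviationCk_mono
          (boostedKerrBackground (mo i).1 (mo i).2 (M i) (a i)) (Ψ i) 2 hτ τ)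
  -- convergence out to the honest radii `max (Rᵢ τ) (max r₊ 0 + 1)` (eventually equal to `Rᵢ τ`)
  have hholes' : ∀ i, Tendsto (fun τ ↦ 𝒟.toSpacetime.truncDeviationCk
      (boostedKerrBackground (mo i).1 (mo i).2 (M i) (a i)) (Ψ i) 2
        (max (R i τ) (max (Kerr.rPlus (M i) (a i)) 0 + 1)) τ) atTop (𝓝 0) := fun i ↦
    (hholes i).congr' (((hR i).eventually_ge_atTop (max (Kerr.rPlus (M i) (a i)) 0 + 1)).mono
      fun τ hτ ↦ (congrArg (fun r : ℝ ↦ 𝒟.toSpacetime.truncDeviationCk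
        (boostedKerrBackground (mo i).1 (mo i).2 (M i) (a i)) (Ψ i) 2 r τ) (max_eq_left hτ)).symm)
  -- the decomposition, restarted at `τ₀ + 1`
  refine ⟨Summit.FinalStateConjecture.exteriorOf 𝒟.toCauchyDevelopment
      (Ψ₀ '' (Minkowski.backgroundOn U₀).lateRegion (τ₀ + 1) ∪
        ⋃ i, Ψ i '' (boostedKerrBackground (mo i).1 (mo i).2 (M i) (a i)).lateRegion (τ₀ + 1)),
    { N := N
      mass := M
      spin := a
      mass_pos := fun i ↦ (hsub i).pos
      abs_spin_le_mass := fun i ↦ le_of_lt (hsub i)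
      motion := mo
      τ₀ := τ₀ + 1
      chart := Ψ
      isLateChart := fun i ↦ isLateChart_restart (hΨ i) h1 (hoK i _)
        ((subset_iUnion (fun i ↦ Ψ i ''
          (boostedKerrBackground (mo i).1 (mo i).2 (M i) (a i)).lateRegion (τ₀ + 1)) i).trans
          (subset_union_right.trans hCO'))
      tendsto_truncDeviationCk := htrunc
      exists_pairwise_disjoint := hsep
      excision := ρ
      tendsto_excision_div := hρ
      flatDomain := U₀
      setOf_lt_excision_subset_flatDomain := fun x hx ↦ hU₀ ⟨(lt_add_one τ₀).trans hx.1, hx.2⟩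
      flatChart := Ψ₀
      isLateChart_flat := isLateChart_restart hΨ₀ h1 (ho0 _) (subset_union_left.trans hCO')
      tendsto_deviationCk_flat := hflat
      diff_subset_causalPast := ?_ }, hsub, rfl,
    -- honest exhaustion radii (audit 2026-08-16 (B)): `max (Rᵢ τ) (max r₊ 0 + 1)`
    fun i τ ↦ max (R i τ) (max (Kerr.rPlus (M i) (a i)) 0 + 1),
    fun i ↦ ⟨tendsto_atTop_mono (fun τ ↦ le_max_left _ _) (hR i), fun τ ↦ le_max_right _ _⟩,
    hholes', fun τ₁ hτ₁ ↦ ?_⟩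
  · -- covering clause at `τ₀ + 1`, from exhaustion of `O` at `τ₀ + 1`
    rintro p ⟨hpO', hpC⟩
    have hp : p ∈ O \ (Ψ₀ '' (Minkowski.backgroundOn U₀).lateRegion (τ₀ + 1) ∪
        ⋃ i, Ψ i '' {x | τ₀ + 1 <
          (boostedKerrBackground (mo i).1 (mo i).2 (M i) (a i)).time x.1 ∧
          (boostedKerrBackground (mo i).1 (mo i).2 (M i) (a i)).radius x.1 ≤
            R i ((boostedKerrBackground (mo i).1 (mo i).2 (M i) (a i)).time x.1)}) := by
      refine ⟨hO'O hpO', ?_⟩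
      rintro (hp0 | hpi)
      · exact hpC (Or.inr hp0)
      · obtain ⟨i, hi⟩ := mem_iUnion.1 hpi
        exact hpC (Or.inl (mem_iUnion.2 ⟨i, image_mono (fun x hx ↦ hx.1) hi⟩))
    exact LorentzianMetric.causalFuture_mono (τ := 𝒟.timeOrientation.reverse)
      (union_subset subset_union_right (subset_union_of_subset_left
        (iUnion_mono fun i ↦ image_mono ((boostedKerrBackground (mo i).1 (mo i).2 (M i)
          (a i)).truncTimeSlab_subset_timeSlab _ _)) _))
      (hexh (τ₀ + 1) (lt_add_one τ₀) hp)
  · -- exhaustion for `τ₁ > τ₀ + 1`, from exhaustion of `O ⊇ O'` at `τ₁`; the certified regions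
    -- and slabs only grow when the radii `Rᵢ` are replaced by `max (Rᵢ ·) (max r₊ 0 + 1)`
    refine (sdiff_le_sdiff hO'O ?_).trans ((hexh τ₁ ((lt_add_one τ₀).trans hτ₁)).trans
      (LorentzianMetric.causalFuture_mono (τ := 𝒟.timeOrientation.reverse) ?_))
    · exact union_subset_union_right _ (iUnion_mono fun i ↦ image_mono fun x hx ↦
        ⟨hx.1, hx.2.trans (le_max_left _ _)⟩)
    · exact union_subset_union_right _ (iUnion_mono fun i ↦ image_mono fun x hx ↦
        ⟨hx.1, hx.2.trans (le_max_left _ _)⟩)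

end Summit.FinalStateConjecture.FinalStateConjecture.Theorems
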